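import Summits.Langlands.Langlands.Theses.DyadicOddResidue
import Literature.NumberTheory.Automorphic.ProModularDeRhamClassicalGL2Q
import Literature.NumberTheory.Automorphic.CompletedCohomologyHeckeAlgebraGLn
import Literature.NumberTheory.Automorphic.FontaineMazurGL2OddPrimeTateTwist
import HarnessLib

/-!
# Crux `DyadicOddResidue.DyadicDihedralFM` (stmt-Langlands-18742), line `Sketch`:
# the stub `stub_classicality` from the named fact `Pan2022_proModularDeRhamClassical_GL2Q`

The registered stub `stub_classicality` of the lead's skeleton (line `Sketch`) is CLASSICALITY AT
`ℓ = 2`: a continuous `ρ : Γ_ℚ → GL₂(ℚ̄₂)` which is residually absolutely irreducible, irreducible,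
unramified almost everywhere, de Rham at `2` with distinct labelled Hodge–Tate weights and
`2`-adically automorphic of some tame level (`BigHeckeGLn.TameLevel.IsPadicallyAutomorphic`, the
tree's "pro-modular") has a Tate twist `ρ ⊗ ε₂^m` attached to a newform away from `N·2`
(`IsGaloisRepOfNewform1`).  This is a PRINTED theorem modulo routine glue — L. Pan,
arXiv:2209.06366, Thm. 1.1.2 = Thm. 7.1.2 ("Fix a prime number `p`": any `p`), with Pan, Forum
Math. Pi 10 (2022), Cor. 6.3.6 (pro-modular and irreducible ⟹ `ρ` appears in `H̃¹`) made
unconditional in `p` by Paškūnas–Tung 2021, Thm. 7.1 — vendored as the named fact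
`Literature.NumberTheory.Automorphic.Pan2022_proModularDeRhamClassical_GL2Q` (stated for EVERY
prime `p`, with literally the stub's hypotheses and conclusion).  Here:

* `stub_classicality` — the registered stub of the lead's skeleton rev 2, which is CURRIED over that
  fact (`Pan2022_proModularDeRhamClassical_GL2Q → classicality at ℓ = 2`; the fact itself is the
  separate registered stub `stub_Pan2022`, the line's declared trust base); the proof specialises
  the fact to `p = ℓ` (the hypothesis `ℓ = 2` is not even used).

No statement of the route file is altered; nothing here closes the crux (the open core is the
lead's `stub_proModularity`).  Sorry-free; axioms `propext`, `Classical.choice`, `Quot.sound`.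
-/

namespace Summit.Langlands.Langlands.Theorems.DyadicDihedralFM

set_option linter.dupNamespace false -- project-wide option; `Summit.Langlands.Langlands` is the mandated namespace

open scoped MatrixGroups ModularForm
open CongruenceSubgroup

/-- **`stub_classicality` of line `Sketch` (crux stmt-Langlands-18742), curried over the named
fact `Pan2022_proModularDeRhamClassical_GL2Q`** (Pan, arXiv:2209.06366, Thm. 1.1.2 = 7.1.2, with
Pan, Forum Math. Pi 2022, Cor. 6.3.6 and Paškūnas–Tung 2021, Thm. 7.1): for `ℓ = 2` and
`ρ : Γ_ℚ → GL₂(ℚ̄_ℓ)` residually absolutely irreducible, irreducible, unramified a.e., de Rham at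
`ℓ` with distinct labelled Hodge–Tate weights and `ℓ`-adically automorphic of some tame level, some
Tate twist `ρ ⊗ χ`, `χ = ε_ℓ^m`, is attached to a newform `f ∈ S_k(Γ₁(N))` away from `N ℓ`.  The
type is VERBATIM the registered signature of `stub_classicality` (skeleton rev 2); the fact is the
same statement for every prime.
[cite: Pan2022LocallyAnalyticII, Thm. 1.1.2 (= Thm. 7.1.2)] [cite: Pan2022LocallyAnalytic, Cor. 6.3.6]
[cite: PaskunasTung2021, Thm. 7.1] -/
theorem stub_classicality : Literature.NumberTheory.Automorphic.Pan2022_proModularDeRhamClassical_GL2Q → ∀ (ℓ : ℕ) [Fact ℓ.Prime], ℓ = 2 → ∀ (ρ : Literature.NumberTheory.GaloisRepresentations.FramedGaloisRep ℚ (PadicAlgCl ℓ) 2), ρ.IsResiduallyAbsIrreducible → ρ.toGaloisRep.IsIrreducible → (∀ᶠ v : IsDedekindDomain.HeightOneSpectrum (NumberField.RingOfIntegers ℚ) in Filter.cofinite, ρ.IsUnramifiedAt v) → (∀ (v : IsDedekindDomain.HeightOneSpectrum (NumberField.RingOfIntegers ℚ)) (hv : ((ℓ : ℕ) : NumberField.RingOfIntegers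 ℚ) ∈ v.asIdeal), (Literature.NumberTheory.PAdicHodge.fontainePstAdicCompletion v ℓ hv).IsDeRhamFramed (ρ.toLocal v) ∧ ∀ τ : v.adicCompletion ℚ →+* PadicAlgCl ℓ, Continuous τ → (ρ.labelledHodgeTateWeightsAt v (Literature.NumberTheory.PAdicHodge.fontainePstAdicCompletion v ℓ hv).algebra (Literature.NumberTheory.PAdicHodge.fontainePstAdicCompletion v ℓ hv).𝔅 τ).Nodup) → (∃ 𝒰 : Literature.NumberTheory.Automorphic.BigHeckeGLn.TameLevel 2 ℚ ℓ, 𝒰.IsPadicallyAutomorphic ρ) → ∃ (χ : Field.absoluteGaloisGroup ℚ →ₜ* (PadicAlgCl ℓ)ˣ) (m : ℤ), (∀ σ, χ σ = Literature.NumberTheory.GaloisRepresentations.cyclotomicPadicAlgCl ℚ ℓ σ ^ m) ∧ ∃ (N : ℕ) (_ : NeZero N) (k : ℤ) (f : CuspForm (CongruenceSubgroup.Gamma1 N) k) (ιf : Literature.NumberTheory.EllipticCurves.ModularForms.coeffCharField f →+* PadicAlgCl ℓ), Literature.NumberTheory.EllipticCurves.ModularForms.IsNewform1 f ∧ Literature.NumberTheory.EllipticCurves.ModularForms.IsGaloisRepOfNewform1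 f ιf {q | q ∣ N * ℓ} (Literature.NumberTheory.GaloisRepresentations.FramedRep.twist ρ χ) := by
  intro h ℓ _ _ ρ hres hirr hunr hdR hpm
  exact h ℓ ρ hres hirr hunr hdR hpm

end Summit.Langlands.Langlands.Theorems.DyadicDihedralFM
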